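import Mathlib
import HarnessLib
import Summits.CriticalPhenomena.Ising3DConformalLimit.Theses.VolterraWard

/-!
# Crux `VolterraWard.TwistFluxConservation` (stmt-CriticalPhenomena-11222) — birth skeleton, line `birth`

Registered by `planner-skel-stmt-CriticalPhenomena-11222-0` (skeleton-register one-shot, 2026-08-17) for route
`route-CriticalPhenomena-VolterraWard` (sub-problem `Ising3DConformalLimit`, crux rank 2).

## The crux (INV, verbatim the route decl)

With the brickwork map `F W M : Site 3 → Site 3` (two integer-division shears of the `(x,y)`-plane, an
`ε = M/W` rotation realised by a staggered grid of screw dislocations), the WALL GRAPH `G_A` on `box 3 N`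
(plain planar bonds in layers `z ≤ A`, `F`-pulled-back planar bonds in layers `z > A`, straight vertical
bonds), `C N W M A n y := ⟨∏ᵢ σ_{yᵢ}⟩` (free b.c., `β = β_c(3)`, `h = 0`, `isingExpect` on `G_A`) and the
`ε`-odd response `D := C(M) − C(−M)`: for every `n`, compact `K ⊆ NonCoincident 3 n`, insertion-free height
slab `[a, a']` and `η > 0`, for `w` small, then `ε` small, then `δ` small, then `N` large, uniformly in `x ∈ K`,
`|D(⌊a/δ⌋) − D(⌊a'/δ⌋)| ≤ η·ε·criticalCorr 3 n [x/δ]` (`W = ⌊w/δ⌋₊`, `M = ⌊εW⌋`).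

## The line: VOLTERRA DIPOLE DECOMPOSITION (kinematics / dynamics cut)

Moving the wall from `A' = ⌊a'/δ⌋` down to `A = ⌊a/δ⌋` re-glues exactly the planar bonds of the layers
`A < z ≤ A'`.  Introduce the SLAB (dipole) GRAPH `S_{A,A'}`: plain planar bonds in layers `z ≤ A` and `z > A'`,
`F`-pulled-back planar bonds in layers `A < z ≤ A'`, straight vertical bonds — an `ε`-rotated insertion-free
slab of critical crystal re-glued into plain crystal on BOTH sides (after relabelling the slab layers by `F`
it is `ℤ³` with a screw-bond layer at `A|A+1` and the inverse screw-bond layer at `A'|A'+1`: a Volterra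
dipole).  As edge modifications of the plain graph on disjoint layer ranges, `G_A = G_{A'} + S_{A,A'}`
(Burgers/Frank additivity of Volterra cuts), so with `CS`, `DS := CS(M) − CS(−M)` the slab correlator and its
odd part,

  `D(A) − D(A') = DS(A,A') + X(M) − X(−M)`,  `X(M) := C_M(A) − C_M(A') − CS_M(A,A') + ⟨∏σ⟩_plain`

(the plain term is `M`-independent and cancels in the antisymmetrisation).  The two stubs:

* STUB 1 `stub_dipoleAdditivity` (KINEMATIC, size L–XL): the antisymmetrised mixed second difference
  `D(A) − D(A') − DS(A,A')` is `≤ η·ε·criticalCorr` in the crux's limit order.  It is a statement about the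
  NON-LINEAR INTERACTION of two disjoint twist regions (upper half-space above `A'`, slab `(A,A']`): formally
  `O(ε²)` by the cumulant expansion, and it holds in ANY theory — isotropic or not — whose twist walls are
  transparent at zeroth order; the honest input is the zeroth-order (even-in-`M`) transparency of fat-screw walls
  and dipoles as `b = εw → 0` at fixed `w`, i.e. the physics of the route's crux `CoreTransparency` (item
  stmt-CriticalPhenomena-11223) in dipole form ("the line uses CORE at `stub_dipoleAdditivity`").  It carries NO
  isotropy content.
* STUB 2 `stub_slabInvisibility` (DYNAMICAL, open-problem level, the load-bearing stub): `|DS(A,A')| ≤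
  η·ε·criticalCorr` — the `ε`-odd response of the critical correlators to an `ε`-rotated INSERTION-FREE SLAB is
  `o(ε)`: literally the route's slogan "an ε-rotated insertion-free slab of critical crystal is invisible at
  O(ε)", i.e. conservation of the angular-momentum flux `Q(A) − Q(A') = 0` (the rotation Ward identity) — THE
  emergent-isotropy content of the crux, now carried by a defect of COMPACT SUPPORT IN HEIGHT with the SAME
  observable on both sides of the comparison (no transport of insertions by `F`, no far-wall / half-space of fat
  screws, no `WallDecay`-type memory enters), and by the mirror identity `F_{W,M} ∘ R = T ∘ R ∘ F_{W,−M}`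
  (`R : p₀ ↦ −1−p₀`, `T : p₁ ↦ p₁ − M`; refuter crux-attack 2026-08-15) a PARITY statement about ONE state: the
  dipole-twisted critical state looks mirror-symmetric at `O(ε)` from outside the slab.

`TwistFluxConservation_of` (sorry-free): apply both stubs with `η/2`, merge the thresholds (`min` of the
`w₀, ε₀, δ₀`, `max` of the `N₀` — all statements nest `w, ε, δ, N` identically) and close with the
real-number seam `|p − q − r| ≤ b/2 ∧ |r| ≤ b/2 ⇒ |p − q| ≤ b` (`dipole_seam`).

Why the cut is honest (not a shred, not a costume): neither stub alone reaches the crux (stub 1 is theory-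
independent kinematics, stub 2 speaks about a different family of graphs), the crux is recovered only through
the four-graph inclusion–exclusion, and stub 2 is the crux's content in the geometry where its mechanism
(torque flux through a slab, Kadanoff–Ceva surface independence of a symmetry twist) is actually stated; the
two-wall form was recorded by the route planner as "equivalent at O(ε), not filed" (route header, NOT
DECOMPOSED YET) — this line files it, with the equivalence made an explicit, separately refutable stub.
Disproof.lean for this crux: none on file (`ledger crux ls`: no workfiles at registration); negatives index of
the summit: no statement about twisted graphs; no `Theorems/TwistFluxConservation/Negative/` lemma landed.
-/

namespace Summit.CriticalPhenomena.Ising3DConformalLimit.Cruxes.TwistFluxConservation.Birth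

open Literature.Probability.LatticeModels

/-! ### §1 The two stub statements (named `Prop`s; `F`, `C`, `D` verbatim from the route decl) -/

/-- **Statement of stub 1 — Volterra dipole additivity (kinematic).**  `F` = the brickwork map, `C`/`D` =
the wall correlator / its `ε`-odd part EXACTLY as in `VolterraWard.TwistFluxConservation`; `CS`/`DS` = the
same for the SLAB GRAPH (planar bonds pulled back by `F` exactly in the layers `A < z ≤ A'`, plain elsewhere,
vertical bonds straight).  Claim: in the crux's limit order (`w`, then `ε`, then `δ`, then `N`, uniformly on
`K`), `|D(⌊a/δ⌋) − D(⌊a'/δ⌋) − DS(⌊a/δ⌋, ⌊a'/δ⌋)| ≤ η·ε·criticalCorr`: the odd responses of the wall move and of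
the dipole slab agree to `o(ε)` (mixed second-order response of two disjoint twist regions).  Why plausibly
true: exact additivity of the edge modifications + cumulant expansion (`O(ε²)`) once walls/dipoles are
transparent at zeroth order (CORE, item 11223, in dipole form); holds for the GFF calibration and for
anisotropic theories alike.  Why it might fail: a fat-screw core of the wall at `A'` (Burgers `M → ∞` sites)
modulating the slab's `O(ε)` odd response by `O(1)` as `ε → 0` at fixed `w` (failure of zeroth-order
transparency, `ν = 1/2`-type marginality). -/
def DipoleAdditivity : Prop :=
  (let F : ℕ → ℤ → Site 3 → Site 3 := fun W M p i =>
      if i = 0 then p 0 - M * (p 1 / (W : ℤ))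
      else if i = 1 then p 1 + M * ((p 0 - M * (p 1 / (W : ℤ))) / (W : ℤ)) else p 2;
    let C : (N W : ℕ) → (M A : ℤ) → (n : ℕ) → (Fin n → Site 3) → ℝ := fun N W M A _n y =>
      isingExpect (SimpleGraph.fromRel fun a b : ↥(box 3 N) =>
          (a.1 2 = b.1 2 ∧ a.1 2 ≤ A ∧ |a.1 0 - b.1 0| + |a.1 1 - b.1 1| = 1) ∨
          (a.1 2 = b.1 2 ∧ A < a.1 2 ∧
            |F W M a.1 0 - F W M b.1 0| + |F W M a.1 1 - F W M b.1 1| = 1) ∨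
          (a.1 0 = b.1 0 ∧ a.1 1 = b.1 1 ∧ |a.1 2 - b.1 2| = 1))
        Finset.univ (criticalBeta 3) 0 BoundaryCondition.free
        (fun s => ∏ i, if h : y i ∈ box 3 N then spinAt (⟨y i, h⟩ : ↥(box 3 N)) s else 0);
    let D : (N W : ℕ) → (M A : ℤ) → (n : ℕ) → (Fin n → Site 3) → ℝ := fun N W M A n y =>
      C N W M A n y - C N W (-M) A n y;
    let T : ℕ → ℤ → ℤ → ℤ → Site 3 → Site 3 := fun W M A A' p =>
      if A < p 2 ∧ p 2 ≤ A' then F W M p else p;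
    let CS : (N W : ℕ) → (M A A' : ℤ) → (n : ℕ) → (Fin n → Site 3) → ℝ := fun N W M A A' _n y =>
      isingExpect (SimpleGraph.fromRel fun a b : ↥(box 3 N) =>
          (a.1 2 = b.1 2 ∧
            |T W M A A' a.1 0 - T W M A A' b.1 0| + |T W M A A' a.1 1 - T W M A A' b.1 1| = 1) ∨
          (a.1 0 = b.1 0 ∧ a.1 1 = b.1 1 ∧ |a.1 2 - b.1 2| = 1))
        Finset.univ (criticalBeta 3) 0 BoundaryCondition.free
        (fun s => ∏ i, if h : y i ∈ box 3 N then spinAt (⟨y i, h⟩ : ↥(box 3 N)) s else 0);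
    let DS : (N W : ℕ) → (M A A' : ℤ) → (n : ℕ) → (Fin n → Site 3) → ℝ := fun N W M A A' n y =>
      CS N W M A A' n y - CS N W (-M) A A' n y;
    ∀ (n : ℕ) (K : Set (Fin n → EuclideanSpace ℝ (Fin 3))), K ⊆ NonCoincident 3 n → IsCompact K →
      ∀ (a a' η : ℝ), a ≤ a' → (∀ x ∈ K, ∀ i, x i 2 < a ∨ a' < x i 2) → 0 < η →
      ∃ w₀ > (0 : ℝ), ∀ w ∈ Set.Ioo 0 w₀, ∃ ε₀ > (0 : ℝ), ∀ ε ∈ Set.Ioo 0 ε₀,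
      ∃ δ₀ > (0 : ℝ), ∀ δ ∈ Set.Ioo 0 δ₀, ∃ N₀ : ℕ, ∀ N ≥ N₀, ∀ x ∈ K,
        |D N ⌊w / δ⌋₊ ⌊ε * ⌊w / δ⌋₊⌋ ⌊a / δ⌋ n (fun i => latticeApprox δ (x i))
          - D N ⌊w / δ⌋₊ ⌊ε * ⌊w / δ⌋₊⌋ ⌊a' / δ⌋ n (fun i => latticeApprox δ (x i))
          - DS N ⌊w / δ⌋₊ ⌊ε * ⌊w / δ⌋₊⌋ ⌊a / δ⌋ ⌊a' / δ⌋ n (fun i => latticeApprox δ (x i))|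
        ≤ η * ε * criticalCorr 3 n (fun i => latticeApprox δ (x i)))

/-- **Statement of stub 2 — slab (Volterra dipole) invisibility (dynamical; the isotropy content).**  With
`F` the brickwork map and `CS`/`DS` the slab-graph correlator / its `ε`-odd part as in `DipoleAdditivity`:
for every `n`, compact `K ⊆ NonCoincident 3 n`, insertion-free height slab `[a, a']` for `K` and `η > 0`, for
`w` small, then `ε` small, then `δ` small, then `N` large, uniformly in `x ∈ K`,
`|DS N W M ⌊a/δ⌋ ⌊a'/δ⌋ n [x/δ]| ≤ η·ε·criticalCorr 3 n [x/δ]` (`W = ⌊w/δ⌋₊`, `M = ⌊εW⌋`): an `ε`-rotated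
insertion-free slab of critical crystal, re-glued into plain crystal above and below, is invisible at `O(ε)`.
Continuum reading: `ε·⟨(Q(a) − Q(a')) ∏σ⟩ = 0`, `Q(t) = ∫_{z=t}` (flux of the orbital angular momentum about
`e₃`) — the rotation Ward identity / conservation of the torque flux through an empty slab.  Why plausibly
true: emergent `O(3)` symmetry of the critical `ℤ³` Ising limit (cubic anisotropy = spin-4 operator,
`Δ ≈ 5.02 > 3`, irrelevant; nothing rigorous).  Why it might fail: exactly the crux's why-might-fail — an
`O_h`-symmetric but anisotropic (subsequential) limit transmits torque through empty slabs; or the achiral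
remnant of the fat screws is only marginal (`ν = 1/2`), leaving an `O(ε)` odd residue of the dipole cores. -/
def SlabInvisibility : Prop :=
  (let F : ℕ → ℤ → Site 3 → Site 3 := fun W M p i =>
      if i = 0 then p 0 - M * (p 1 / (W : ℤ))
      else if i = 1 then p 1 + M * ((p 0 - M * (p 1 / (W : ℤ))) / (W : ℤ)) else p 2;
    let T : ℕ → ℤ → ℤ → ℤ → Site 3 → Site 3 := fun W M A A' p =>
      if A < p 2 ∧ p 2 ≤ A' then F W M p else p;
    let CS : (N W : ℕ) → (M A A' : ℤ) → (n : ℕ) → (Fin n → Site 3) → ℝ := fun N W M A A' _n y =>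
      isingExpect (SimpleGraph.fromRel fun a b : ↥(box 3 N) =>
          (a.1 2 = b.1 2 ∧
            |T W M A A' a.1 0 - T W M A A' b.1 0| + |T W M A A' a.1 1 - T W M A A' b.1 1| = 1) ∨
          (a.1 0 = b.1 0 ∧ a.1 1 = b.1 1 ∧ |a.1 2 - b.1 2| = 1))
        Finset.univ (criticalBeta 3) 0 BoundaryCondition.free
        (fun s => ∏ i, if h : y i ∈ box 3 N then spinAt (⟨y i, h⟩ : ↥(box 3 N)) s else 0);
    let DS : (N W : ℕ) → (M A A' : ℤ) → (n : ℕ) → (Fin n → Site 3) → ℝ := fun N W M A A' n y =>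
      CS N W M A A' n y - CS N W (-M) A A' n y;
    ∀ (n : ℕ) (K : Set (Fin n → EuclideanSpace ℝ (Fin 3))), K ⊆ NonCoincident 3 n → IsCompact K →
      ∀ (a a' η : ℝ), a ≤ a' → (∀ x ∈ K, ∀ i, x i 2 < a ∨ a' < x i 2) → 0 < η →
      ∃ w₀ > (0 : ℝ), ∀ w ∈ Set.Ioo 0 w₀, ∃ ε₀ > (0 : ℝ), ∀ ε ∈ Set.Ioo 0 ε₀,
      ∃ δ₀ > (0 : ℝ), ∀ δ ∈ Set.Ioo 0 δ₀, ∃ N₀ : ℕ, ∀ N ≥ N₀, ∀ x ∈ K,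
        |DS N ⌊w / δ⌋₊ ⌊ε * ⌊w / δ⌋₊⌋ ⌊a / δ⌋ ⌊a' / δ⌋ n (fun i => latticeApprox δ (x i))|
        ≤ η * ε * criticalCorr 3 n (fun i => latticeApprox δ (x i)))

/-! ### §2 The registered stubs (the only `sorry`s of this file) -/

/-- stub 1 (kinematic; size L–XL; uses CORE-type zeroth-order transparency): Volterra dipole additivity. -/
theorem stub_dipoleAdditivity : DipoleAdditivity := by
  sorry

/-- stub 2 (dynamical; open-problem level; HARDEST, load-bearing): invisibility of an `ε`-rotated
insertion-free slab at `O(ε)` — the torque-flux conservation / rotation Ward identity in dipole form. -/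
theorem stub_slabInvisibility : SlabInvisibility := by
  sorry

/-! ### Name-keyed aliases of the stub statements (the hypotheses of the composition) -/
namespace Registered

/-- Alias of `DipoleAdditivity` keyed by the registered stub name. -/
abbrev stub_dipoleAdditivity : Prop := DipoleAdditivity
/-- Alias of `SlabInvisibility` keyed by the registered stub name. -/
abbrev stub_slabInvisibility : Prop := SlabInvisibility

end Registered

/-! ### §3 The composition: the two stubs give the crux, BY NAME -/

/-- The real-number seam of the dipole decomposition: `|p − q − r| ≤ b/2` and `|r| ≤ b/2` give
`|p − q| ≤ b` (here `b = η·ε·c`). -/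
theorem dipole_seam {p q r η ε c : ℝ} (h₁ : |p - q - r| ≤ η / 2 * ε * c) (h₂ : |r| ≤ η / 2 * ε * c) :
    |p - q| ≤ η * ε * c := by
  rw [abs_le] at h₁ h₂ ⊢
  constructor <;> linarith [h₁.1, h₁.2, h₂.1, h₂.2]

/-- **`TwistFluxConservation` from the Volterra dipole line.**  Hypotheses = exactly the two registered
stubs.  Proof: both stubs at `η/2`; common thresholds `min w₀`, `min ε₀`, `min δ₀`, `max N₀` (the four
statements nest `w, ε, δ, N` identically); then `dipole_seam` on
`D(A) − D(A') = (D(A) − D(A') − DS(A,A')) + DS(A,A')`. -/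
theorem TwistFluxConservation_of (hadd : Registered.stub_dipoleAdditivity)
    (hslab : Registered.stub_slabInvisibility) :
    Summit.CriticalPhenomena.Ising3DConformalLimit.Theses.VolterraWard.TwistFluxConservation := by
  dsimp only [Registered.stub_dipoleAdditivity, Registered.stub_slabInvisibility, DipoleAdditivity,
    SlabInvisibility] at hadd hslab
  dsimp only [Summit.CriticalPhenomena.Ising3DConformalLimit.Theses.VolterraWard.TwistFluxConservation]
  intro n K hK hKc a a' η hle hfree hη
  obtain ⟨w₁, hw₁, H₁⟩ := hadd n K hK hKc a a' (η / 2) hle hfree (half_pos hη)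
  obtain ⟨w₂, hw₂, H₂⟩ := hslab n K hK hKc a a' (η / 2) hle hfree (half_pos hη)
  refine ⟨min w₁ w₂, lt_min hw₁ hw₂, fun w hw => ?_⟩
  obtain ⟨ε₁, hε₁, H₁⟩ := H₁ w ⟨hw.1, lt_of_lt_of_le hw.2 (min_le_left _ _)⟩
  obtain ⟨ε₂, hε₂, H₂⟩ := H₂ w ⟨hw.1, lt_of_lt_of_le hw.2 (min_le_right _ _)⟩
  refine ⟨min ε₁ ε₂, lt_min hε₁ hε₂, fun ε hε => ?_⟩
  obtain ⟨δ₁, hδ₁, H₁⟩ := H₁ ε ⟨hε.1, lt_of_lt_of_le hε.2 (min_le_left _ _)⟩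
  obtain ⟨δ₂, hδ₂, H₂⟩ := H₂ ε ⟨hε.1, lt_of_lt_of_le hε.2 (min_le_right _ _)⟩
  refine ⟨min δ₁ δ₂, lt_min hδ₁ hδ₂, fun δ hδ => ?_⟩
  obtain ⟨N₁, H₁⟩ := H₁ δ ⟨hδ.1, lt_of_lt_of_le hδ.2 (min_le_left _ _)⟩
  obtain ⟨N₂, H₂⟩ := H₂ δ ⟨hδ.1, lt_of_lt_of_le hδ.2 (min_le_right _ _)⟩
  refine ⟨max N₁ N₂, fun N hN x hx => ?_⟩
  exact dipole_seam (H₁ N (le_of_max_le_left hN) x hx) (H₂ N (le_of_max_le_right hN) x hx)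

/-- The crux from the registered stubs plugged in (closed modulo exactly `stub_dipoleAdditivity`,
`stub_slabInvisibility`: the file's only `sorry`s feed it). -/
theorem TwistFluxConservation_proof :
    Summit.CriticalPhenomena.Ising3DConformalLimit.Theses.VolterraWard.TwistFluxConservation :=
  TwistFluxConservation_of stub_dipoleAdditivity stub_slabInvisibility

end Summit.CriticalPhenomena.Ising3DConformalLimit.Cruxes.TwistFluxConservation.Birth
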